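import Summits.Ventures.CertifiedManyBodySolver.Observables.PhaseSeparationExclusionTPrimeStripHighUThermal
import Summits.Ventures.CertifiedManyBodySolver.Observables.PhaseSeparationExclusionTPrimeStripGrandCanonical
import HarnessLib

/-!
# Ventures/CertifiedManyBodySolver — Observables/PhaseSeparationExclusionTPrimeStripHighUGrandCanonical.lean: hubbard-box-p3 g27's LARGE-`U`
# strip competing-order words (p673220 / p673575) READ ON THE CHEMICAL-POTENTIAL AXIS (`T = 0`): `(≤ 1/5 | ≥ 1)`: `Δμ ≥ t/3` on
# `t′ ∈ [−3/20, 0] × U ∈ [8, 12]`, `Δμ ≥ 12t/25` on `× [8, 10]`, `Δμ ≥ 9t/20` on `[−1/5, 0] × [8, 10]`, `Δμ ≥ t/8` on `[−1/4, 0] × [8, 10]`;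
# `(≤ 1/4 | ≥ 1)`: `Δμ ≥ t/4` on `[−3/20, 0] × [8, 10]` and `[−1/5, 0] × [8, 10]`; `(≤ 3/10 | ≥ 1)`: `Δμ ≥ t/4` on `[−1/10, 0] × [8, 9]`

HONEST FRAMING: first certified bounds; not a superconductivity verdict. CLASS = DERIVED / CONTEXT: the grand-canonical (μ-axis) reading of box-p3
g27's large-`U` strip cells — their cap plane, `U = 8` K2DIAG law and TRIANGLE `n = 1` laws `tri_n1_law{12h,10f,10m,12t}_of` (joint concavity; Mott
column #489 / #502) with the `U`-chorded intermediate laws of `…TPrimeStripHighUThermal.lean` §0, and their dilute kernel rows, fed to this seat's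
cell law `psGC_gap_on_cell_of_columns` (g22: a translation-invariant ground state of `H − μN` is a canonical ground state at its density and `μ`
a subgradient ⇒ `a·b·(1 − n₁)·(μ₂ − μ₁) ≥ M`). CONTROL class; conditional BY NAME on box-p3's claim nodes (VARBOX plane
`cert_obx32x4tpm1o4D1200_openbox_32x4_N112_planes`, `cert_laBoxE_K2diag_GU8n1tpm3o10_j299783_up`, #472 · #428 · #489 · #502); a FLOOR on `Δμ`,
not an estimate; statements about translation-invariant mean-energy minimisers of `H(1,s,U) − μN` (existence not claimed); nothing about stripes /
which phase is realised / SC / `T_c`; no number of record. Zero compute, no anchors (pure `T = 0`), no `sorry`.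

Cell `pub/hubbard-downfold` (MO-S1 ↔ S2 seam; D-0096 (iii), μ axis), seat `hubbard-downfold-unc-2` (g24). `g = Δμ·a·b·(1 − n₁)` is checked below
every column margin (exact, `gen-g24/gen_fileG.py`; margins = box-p3's §E table). READING (D-0098 μ-axis annotation, CONTROL): «routed one-band
boxes with t′/t ∈ [−0.15, 0] and U/t ∈ [8, 12]: every μ carrying a half-filled-or-denser ground state lies at least t/3 above every μ carrying a
ground state of hole doping ≥ 80 %; the grand-canonical density never jumps from ≤ 1/5 to ≥ 1».
WHAT THIS IS NOT: a certificate; a CERTIFIED row; an estimate of `μ(n)`; a statement at `t′ < s₁`, `t′ > 0`, other `U`, `T > 0`, or about SC.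
References: [Israel1979] Thm I.2.4 / I.3.4; [Ruelle1969] §3.3–3.4; [Griffiths1964]; [EmeryKivelsonLin1990].
-/

noncomputable section

namespace Summit.Ventures.CertifiedManyBodySolver.Observables

open Summit.Ventures.CertifiedManyBodySolver.Certificates Summit.Ventures.CertifiedManyBodySolver.Downfold
open Literature.MathematicalPhysics.QuantumLattice Literature.MathematicalPhysics.QuantumLattice.ThermodynamicLimit
open Literature.MathematicalPhysics.QuantumLattice.InfVolFermionState Set Filter

/-! ## §1 `(≤ 1/5 | ≥ 1)` on the μ axis at large `U` (`T = 0`) -/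

/-- **`Δμ ≥ t/3` on `t′ ∈ [−3/20, 0] × U ∈ [8, 12]`** between any `μ₁` carrying a `≤ 1/5`-filled and any `μ₂` carrying a `≥ 1`-filled translation-invariant ground state (columns `U = 8` law ∣ `tri_n1_law12h_of`) (`g = 9 / 256` ≤ every column margin, `M_min = 0.0375`). [cite: Israel1979, Thm. I.2.4] [cite: EmeryKivelsonLin1990, pp. 475–476] [cite: Ruelle1969, §3.3] -/
theorem highU_chemPot_gap_1o3_le_1o5_ge_one_A (hVB : cert_obx32x4tpm1o4D1200_openbox_32x4_N112_planes)
    (hK8 : cert_laBoxE_K2diag_GU8n1tpm3o10_j299783_up)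
    (h472 : cert_r472_pb2_tl_upper_n1_U8) (h428 : cert_r428_hubSQ_hanK7R6_U8_r5_e4_so4blk)
    (h502 : cert_r502_hubSQ_hanK7R6_U16_r5_e4_so4blk)
    {s : ℝ} (hs : s ∈ Icc (-3 / 20 : ℝ) 0) {U : ℝ} (hU : U ∈ Icc (8 : ℝ) (12))
    {μ₁ μ₂ : ℝ} {ω₁ ω₂ : InfVolFermionState 2}
    (hω₁ : ω₁.IsMeanEnergyMinimiser (hubbardTTPrimeMuInteraction 1 s U μ₁) 1) (hρ₁ : ω₁.density ≤ 1 / 5)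
    (hω₂ : ω₂.IsMeanEnergyMinimiser (hubbardTTPrimeMuInteraction 1 s U μ₂) 1) (hρ₂ : 1 ≤ ω₂.density) :
    (1 : ℝ) / 3 ≤ μ₂ - μ₁ := by
  have k := psGC_gap_on_cell_of_columns 1 (s₁ := -3 / 20) (s₂ := 0) (U₁ := 8) (U₂ := 12)
    (n₁ := 1 / 5) (n₂ := 1) (a := 5 / 32) (b := 27 / 32) (g := 9 / 256)
    (by norm_num) (by norm_num) (by norm_num) (by norm_num) (by norm_num) (by norm_num) (by norm_num) (by norm_num)
    (lsco78_capPlane_on_cell_of hVB (by norm_num) (by norm_num) (by norm_num))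
    (fun s hs => lsco_n1_law8_of hK8 h472 h428 s ⟨hs.1.trans' (by norm_num), hs.2⟩)
    (fun s hs => tri_n1_law12h_of hK8 h472 h428 h502 s hs)
    (fun s hs U hU => strip_dilute1o5_floor (n₁ := 1 / 5) (by norm_num) (by norm_num) s ⟨hs.1.trans' (by norm_num), hs.2⟩ U (by linarith [hU.1]))
    ?_ ?_ hs hU hω₁ (meanEnergy_hubbardTTPrimeMu_eq_sub 1 s U μ₁) hω₂ (meanEnergy_hubbardTTPrimeMu_eq_sub 1 s U μ₂) hρ₁ hρ₂
  · linarith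
  · intro s hs; obtain ⟨h1, h2⟩ := hs; push_cast; norm_num; nlinarith [h1, h2]
  · intro s hs; obtain ⟨h1, h2⟩ := hs; push_cast; norm_num; nlinarith [h1, h2]

/-- **No `μ` carries both** a `≤ 1 / 5`-filled and a `≥ 1`-filled translation-invariant ground state of `H(1,s,U) − μN`, for every `(s, U) ∈ [-3 / 20, 0] × [8, 12]` (`T = 0`). [cite: Israel1979, Thm. I.2.4] [cite: EmeryKivelsonLin1990, pp. 475–476] -/
theorem highU_noMu_1o3_le_1o5_ge_one_A (hVB : cert_obx32x4tpm1o4D1200_openbox_32x4_N112_planes)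
    (hK8 : cert_laBoxE_K2diag_GU8n1tpm3o10_j299783_up)
    (h472 : cert_r472_pb2_tl_upper_n1_U8) (h428 : cert_r428_hubSQ_hanK7R6_U8_r5_e4_so4blk)
    (h502 : cert_r502_hubSQ_hanK7R6_U16_r5_e4_so4blk)
    {s : ℝ} (hs : s ∈ Icc (-3 / 20 : ℝ) 0) {U : ℝ} (hU : U ∈ Icc (8 : ℝ) (12))
    {μ : ℝ} {ω₁ ω₂ : InfVolFermionState 2} (hω₁ : ω₁.IsMeanEnergyMinimiser (hubbardTTPrimeMuInteraction 1 s U μ) 1)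
    (hρ₁ : ω₁.density ≤ 1 / 5) (hρ₂ : 1 ≤ ω₂.density) :
    ¬ ω₂.IsMeanEnergyMinimiser (hubbardTTPrimeMuInteraction 1 s U μ) 1 := by
  intro hω₂
  have h := highU_chemPot_gap_1o3_le_1o5_ge_one_A hVB hK8 h472 h428 h502 hs hU hω₁ hρ₁ hω₂ hρ₂
  norm_num at h

/-- **`Δμ ≥ 12t/25` on `t′ ∈ [−3/20, 0] × U ∈ [8, 10]`** (second column = `hU_n1_law10_of_12h`) (`g = 81 / 1600` ≤ every column margin, `M_min = 0.0523`). [cite: Israel1979, Thm. I.2.4] [cite: EmeryKivelsonLin1990, pp. 475–476] [cite: Ruelle1969, §3.3] -/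
theorem highU_chemPot_gap_12o25_le_1o5_ge_one_A10 (hVB : cert_obx32x4tpm1o4D1200_openbox_32x4_N112_planes)
    (hK8 : cert_laBoxE_K2diag_GU8n1tpm3o10_j299783_up)
    (h472 : cert_r472_pb2_tl_upper_n1_U8) (h428 : cert_r428_hubSQ_hanK7R6_U8_r5_e4_so4blk)
    (h502 : cert_r502_hubSQ_hanK7R6_U16_r5_e4_so4blk)
    {s : ℝ} (hs : s ∈ Icc (-3 / 20 : ℝ) 0) {U : ℝ} (hU : U ∈ Icc (8 : ℝ) (10))
    {μ₁ μ₂ : ℝ} {ω₁ ω₂ : InfVolFermionState 2}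
    (hω₁ : ω₁.IsMeanEnergyMinimiser (hubbardTTPrimeMuInteraction 1 s U μ₁) 1) (hρ₁ : ω₁.density ≤ 1 / 5)
    (hω₂ : ω₂.IsMeanEnergyMinimiser (hubbardTTPrimeMuInteraction 1 s U μ₂) 1) (hρ₂ : 1 ≤ ω₂.density) :
    (12 : ℝ) / 25 ≤ μ₂ - μ₁ := by
  have k := psGC_gap_on_cell_of_columns 1 (s₁ := -3 / 20) (s₂ := 0) (U₁ := 8) (U₂ := 10)
    (n₁ := 1 / 5) (n₂ := 1) (a := 5 / 32) (b := 27 / 32) (g := 81 / 1600)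
    (by norm_num) (by norm_num) (by norm_num) (by norm_num) (by norm_num) (by norm_num) (by norm_num) (by norm_num)
    (lsco78_capPlane_on_cell_of hVB (by norm_num) (by norm_num) (by norm_num))
    (fun s hs => lsco_n1_law8_of hK8 h472 h428 s ⟨hs.1.trans' (by norm_num), hs.2⟩)
    (hU_n1_law10_of_12h hK8 h472 h428 h502)
    (fun s hs U hU => strip_dilute1o5_floor (n₁ := 1 / 5) (by norm_num) (by norm_num) s ⟨hs.1.trans' (by norm_num), hs.2⟩ U (by linarith [hU.1]))
    ?_ ?_ hs hU hω₁ (meanEnergy_hubbardTTPrimeMu_eq_sub 1 s U μ₁) hω₂ (meanEnergy_hubbardTTPrimeMu_eq_sub 1 s U μ₂) hρ₁ hρ₂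
  · linarith
  · intro s hs; obtain ⟨h1, h2⟩ := hs; push_cast; norm_num; nlinarith [h1, h2]
  · intro s hs; obtain ⟨h1, h2⟩ := hs; push_cast; norm_num; nlinarith [h1, h2]

/-- **No `μ` carries both** a `≤ 1 / 5`-filled and a `≥ 1`-filled translation-invariant ground state of `H(1,s,U) − μN`, for every `(s, U) ∈ [-3 / 20, 0] × [8, 10]` (`T = 0`). [cite: Israel1979, Thm. I.2.4] [cite: EmeryKivelsonLin1990, pp. 475–476] -/
theorem highU_noMu_12o25_le_1o5_ge_one_A10 (hVB : cert_obx32x4tpm1o4D1200_openbox_32x4_N112_planes)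
    (hK8 : cert_laBoxE_K2diag_GU8n1tpm3o10_j299783_up)
    (h472 : cert_r472_pb2_tl_upper_n1_U8) (h428 : cert_r428_hubSQ_hanK7R6_U8_r5_e4_so4blk)
    (h502 : cert_r502_hubSQ_hanK7R6_U16_r5_e4_so4blk)
    {s : ℝ} (hs : s ∈ Icc (-3 / 20 : ℝ) 0) {U : ℝ} (hU : U ∈ Icc (8 : ℝ) (10))
    {μ : ℝ} {ω₁ ω₂ : InfVolFermionState 2} (hω₁ : ω₁.IsMeanEnergyMinimiser (hubbardTTPrimeMuInteraction 1 s U μ) 1)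
    (hρ₁ : ω₁.density ≤ 1 / 5) (hρ₂ : 1 ≤ ω₂.density) :
    ¬ ω₂.IsMeanEnergyMinimiser (hubbardTTPrimeMuInteraction 1 s U μ) 1 := by
  intro hω₂
  have h := highU_chemPot_gap_12o25_le_1o5_ge_one_A10 hVB hK8 h472 h428 h502 hs hU hω₁ hρ₁ hω₂ hρ₂
  norm_num at h

/-- **`Δμ ≥ 9t/20` on `t′ ∈ [−1/5, 0] × U ∈ [8, 10]`** (columns `U = 8` law ∣ `tri_n1_law10m_of`) (`g = 243 / 5120` ≤ every column margin, `M_min = 0.0485`). [cite: Israel1979, Thm. I.2.4] [cite: EmeryKivelsonLin1990, pp. 475–476] [cite: Ruelle1969, §3.3] -/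
theorem highU_chemPot_gap_9o20_le_1o5_ge_one_B (hVB : cert_obx32x4tpm1o4D1200_openbox_32x4_N112_planes)
    (hK8 : cert_laBoxE_K2diag_GU8n1tpm3o10_j299783_up)
    (h472 : cert_r472_pb2_tl_upper_n1_U8) (h428 : cert_r428_hubSQ_hanK7R6_U8_r5_e4_so4blk)
    (h489 : cert_r489_hubSQ_hanK7R6_U12_r5_e4_so4blk) (h502 : cert_r502_hubSQ_hanK7R6_U16_r5_e4_so4blk)
    {s : ℝ} (hs : s ∈ Icc (-1 / 5 : ℝ) 0) {U : ℝ} (hU : U ∈ Icc (8 : ℝ) (10))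
    {μ₁ μ₂ : ℝ} {ω₁ ω₂ : InfVolFermionState 2}
    (hω₁ : ω₁.IsMeanEnergyMinimiser (hubbardTTPrimeMuInteraction 1 s U μ₁) 1) (hρ₁ : ω₁.density ≤ 1 / 5)
    (hω₂ : ω₂.IsMeanEnergyMinimiser (hubbardTTPrimeMuInteraction 1 s U μ₂) 1) (hρ₂ : 1 ≤ ω₂.density) :
    (9 : ℝ) / 20 ≤ μ₂ - μ₁ := by
  have k := psGC_gap_on_cell_of_columns 1 (s₁ := -1 / 5) (s₂ := 0) (U₁ := 8) (U₂ := 10)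
    (n₁ := 1 / 5) (n₂ := 1) (a := 5 / 32) (b := 27 / 32) (g := 243 / 5120)
    (by norm_num) (by norm_num) (by norm_num) (by norm_num) (by norm_num) (by norm_num) (by norm_num) (by norm_num)
    (lsco78_capPlane_on_cell_of hVB (by norm_num) (by norm_num) (by norm_num))
    (fun s hs => lsco_n1_law8_of hK8 h472 h428 s ⟨hs.1.trans' (by norm_num), hs.2⟩)
    (fun s hs => tri_n1_law10m_of hK8 h472 h428 h489 h502 s hs)
    (fun s hs U hU => strip_dilute1o5_floor (n₁ := 1 / 5) (by norm_num) (by norm_num) s ⟨hs.1.trans' (by norm_num), hs.2⟩ U (by linarith [hU.1]))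
    ?_ ?_ hs hU hω₁ (meanEnergy_hubbardTTPrimeMu_eq_sub 1 s U μ₁) hω₂ (meanEnergy_hubbardTTPrimeMu_eq_sub 1 s U μ₂) hρ₁ hρ₂
  · linarith
  · intro s hs; obtain ⟨h1, h2⟩ := hs; push_cast; norm_num; nlinarith [h1, h2]
  · intro s hs; obtain ⟨h1, h2⟩ := hs; push_cast; norm_num; nlinarith [h1, h2]

/-- **No `μ` carries both** a `≤ 1 / 5`-filled and a `≥ 1`-filled translation-invariant ground state of `H(1,s,U) − μN`, for every `(s, U) ∈ [-1 / 5, 0] × [8, 10]` (`T = 0`). [cite: Israel1979, Thm. I.2.4] [cite: EmeryKivelsonLin1990, pp. 475–476] -/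
theorem highU_noMu_9o20_le_1o5_ge_one_B (hVB : cert_obx32x4tpm1o4D1200_openbox_32x4_N112_planes)
    (hK8 : cert_laBoxE_K2diag_GU8n1tpm3o10_j299783_up)
    (h472 : cert_r472_pb2_tl_upper_n1_U8) (h428 : cert_r428_hubSQ_hanK7R6_U8_r5_e4_so4blk)
    (h489 : cert_r489_hubSQ_hanK7R6_U12_r5_e4_so4blk) (h502 : cert_r502_hubSQ_hanK7R6_U16_r5_e4_so4blk)
    {s : ℝ} (hs : s ∈ Icc (-1 / 5 : ℝ) 0) {U : ℝ} (hU : U ∈ Icc (8 : ℝ) (10))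
    {μ : ℝ} {ω₁ ω₂ : InfVolFermionState 2} (hω₁ : ω₁.IsMeanEnergyMinimiser (hubbardTTPrimeMuInteraction 1 s U μ) 1)
    (hρ₁ : ω₁.density ≤ 1 / 5) (hρ₂ : 1 ≤ ω₂.density) :
    ¬ ω₂.IsMeanEnergyMinimiser (hubbardTTPrimeMuInteraction 1 s U μ) 1 := by
  intro hω₂
  have h := highU_chemPot_gap_9o20_le_1o5_ge_one_B hVB hK8 h472 h428 h489 h502 hs hU hω₁ hρ₁ hω₂ hρ₂
  norm_num at h

/-- **`Δμ ≥ t/8` on `t′ ∈ [−1/4, 0] × U ∈ [8, 10]`** (columns `U = 8` law ∣ `tri_n1_law10f_of`; the `(−1/4, 10)` corner margin is `0.015`) (`g = 27 / 2048` ≤ every column margin, `M_min = 0.0154`). [cite: Israel1979, Thm. I.2.4] [cite: EmeryKivelsonLin1990, pp. 475–476] [cite: Ruelle1969, §3.3] -/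
theorem highU_chemPot_gap_1o8_le_1o5_ge_one_C (hVB : cert_obx32x4tpm1o4D1200_openbox_32x4_N112_planes)
    (hK8 : cert_laBoxE_K2diag_GU8n1tpm3o10_j299783_up)
    (h472 : cert_r472_pb2_tl_upper_n1_U8) (h428 : cert_r428_hubSQ_hanK7R6_U8_r5_e4_so4blk)
    (h502 : cert_r502_hubSQ_hanK7R6_U16_r5_e4_so4blk)
    {s : ℝ} (hs : s ∈ Icc (-1 / 4 : ℝ) 0) {U : ℝ} (hU : U ∈ Icc (8 : ℝ) (10))
    {μ₁ μ₂ : ℝ} {ω₁ ω₂ : InfVolFermionState 2}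
    (hω₁ : ω₁.IsMeanEnergyMinimiser (hubbardTTPrimeMuInteraction 1 s U μ₁) 1) (hρ₁ : ω₁.density ≤ 1 / 5)
    (hω₂ : ω₂.IsMeanEnergyMinimiser (hubbardTTPrimeMuInteraction 1 s U μ₂) 1) (hρ₂ : 1 ≤ ω₂.density) :
    (1 : ℝ) / 8 ≤ μ₂ - μ₁ := by
  have k := psGC_gap_on_cell_of_columns 1 (s₁ := -1 / 4) (s₂ := 0) (U₁ := 8) (U₂ := 10)
    (n₁ := 1 / 5) (n₂ := 1) (a := 5 / 32) (b := 27 / 32) (g := 27 / 2048)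
    (by norm_num) (by norm_num) (by norm_num) (by norm_num) (by norm_num) (by norm_num) (by norm_num) (by norm_num)
    (lsco78_capPlane_on_cell_of hVB (by norm_num) (by norm_num) (by norm_num))
    (fun s hs => lsco_n1_law8_of hK8 h472 h428 s ⟨hs.1.trans' (by norm_num), hs.2⟩)
    (fun s hs => tri_n1_law10f_of hK8 h472 h428 h502 s hs)
    (fun s hs U hU => highU_dilute1o5_floor_q (n₁ := 1 / 5) (by norm_num) (by norm_num) s ⟨hs.1.trans' (by norm_num), hs.2⟩ U (by linarith [hU.1]))
    ?_ ?_ hs hU hω₁ (meanEnergy_hubbardTTPrimeMu_eq_sub 1 s U μ₁) hω₂ (meanEnergy_hubbardTTPrimeMu_eq_sub 1 s U μ₂) hρ₁ hρ₂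
  · linarith
  · intro s hs; obtain ⟨h1, h2⟩ := hs; push_cast; norm_num; nlinarith [h1, h2]
  · intro s hs; obtain ⟨h1, h2⟩ := hs; push_cast; norm_num; nlinarith [h1, h2]

/-- **No `μ` carries both** a `≤ 1 / 5`-filled and a `≥ 1`-filled translation-invariant ground state of `H(1,s,U) − μN`, for every `(s, U) ∈ [-1 / 4, 0] × [8, 10]` (`T = 0`). [cite: Israel1979, Thm. I.2.4] [cite: EmeryKivelsonLin1990, pp. 475–476] -/
theorem highU_noMu_1o8_le_1o5_ge_one_C (hVB : cert_obx32x4tpm1o4D1200_openbox_32x4_N112_planes)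
    (hK8 : cert_laBoxE_K2diag_GU8n1tpm3o10_j299783_up)
    (h472 : cert_r472_pb2_tl_upper_n1_U8) (h428 : cert_r428_hubSQ_hanK7R6_U8_r5_e4_so4blk)
    (h502 : cert_r502_hubSQ_hanK7R6_U16_r5_e4_so4blk)
    {s : ℝ} (hs : s ∈ Icc (-1 / 4 : ℝ) 0) {U : ℝ} (hU : U ∈ Icc (8 : ℝ) (10))
    {μ : ℝ} {ω₁ ω₂ : InfVolFermionState 2} (hω₁ : ω₁.IsMeanEnergyMinimiser (hubbardTTPrimeMuInteraction 1 s U μ) 1)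
    (hρ₁ : ω₁.density ≤ 1 / 5) (hρ₂ : 1 ≤ ω₂.density) :
    ¬ ω₂.IsMeanEnergyMinimiser (hubbardTTPrimeMuInteraction 1 s U μ) 1 := by
  intro hω₂
  have h := highU_chemPot_gap_1o8_le_1o5_ge_one_C hVB hK8 h472 h428 h502 hs hU hω₁ hρ₁ hω₂ hρ₂
  norm_num at h

/-! ## §2 `(≤ 1/4 | ≥ 1)` and `(≤ 3/10 | ≥ 1)` on the μ axis at large `U` (`T = 0`) -/

/-- **`(≤ 1/4 | ≥ 1)`: `Δμ ≥ t/4` on `t′ ∈ [−3/20, 0] × U ∈ [8, 10]`** (second column `hU_n1_law10_of_12h`; rows touching at `1/4`) (`g = 5 / 192` ≤ every column margin, `M_min = 0.0311`). [cite: Israel1979, Thm. I.2.4] [cite: EmeryKivelsonLin1990, pp. 475–476] [cite: Ruelle1969, §3.3] -/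
theorem highU_chemPot_gap_1o4_le_1o4_ge_one_A10 (hVB : cert_obx32x4tpm1o4D1200_openbox_32x4_N112_planes)
    (hK8 : cert_laBoxE_K2diag_GU8n1tpm3o10_j299783_up)
    (h472 : cert_r472_pb2_tl_upper_n1_U8) (h428 : cert_r428_hubSQ_hanK7R6_U8_r5_e4_so4blk)
    (h502 : cert_r502_hubSQ_hanK7R6_U16_r5_e4_so4blk)
    {s : ℝ} (hs : s ∈ Icc (-3 / 20 : ℝ) 0) {U : ℝ} (hU : U ∈ Icc (8 : ℝ) (10))
    {μ₁ μ₂ : ℝ} {ω₁ ω₂ : InfVolFermionState 2}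
    (hω₁ : ω₁.IsMeanEnergyMinimiser (hubbardTTPrimeMuInteraction 1 s U μ₁) 1) (hρ₁ : ω₁.density ≤ 1 / 4)
    (hω₂ : ω₂.IsMeanEnergyMinimiser (hubbardTTPrimeMuInteraction 1 s U μ₂) 1) (hρ₂ : 1 ≤ ω₂.density) :
    (1 : ℝ) / 4 ≤ μ₂ - μ₁ := by
  have k := psGC_gap_on_cell_of_columns 1 (s₁ := -3 / 20) (s₂ := 0) (U₁ := 8) (U₂ := 10)
    (n₁ := 1 / 4) (n₂ := 1) (a := 1 / 6) (b := 5 / 6) (g := 5 / 192)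
    (by norm_num) (by norm_num) (by norm_num) (by norm_num) (by norm_num) (by norm_num) (by norm_num) (by norm_num)
    (lsco78_capPlane_on_cell_of hVB (by norm_num) (by norm_num) (by norm_num))
    (fun s hs => lsco_n1_law8_of hK8 h472 h428 s ⟨hs.1.trans' (by norm_num), hs.2⟩)
    (hU_n1_law10_of_12h hK8 h472 h428 h502)
    (fun s hs U hU => strip_dilute1o4_floor (n₁ := 1 / 4) (by norm_num) (by norm_num) s ⟨hs.1.trans' (by norm_num), hs.2⟩ U (by linarith [hU.1]))
    ?_ ?_ hs hU hω₁ (meanEnergy_hubbardTTPrimeMu_eq_sub 1 s U μ₁) hω₂ (meanEnergy_hubbardTTPrimeMu_eq_sub 1 s U μ₂) hρ₁ hρ₂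
  · linarith
  · intro s hs; obtain ⟨h1, h2⟩ := hs; push_cast; norm_num; nlinarith [h1, h2]
  · intro s hs; obtain ⟨h1, h2⟩ := hs; push_cast; norm_num; nlinarith [h1, h2]

/-- **No `μ` carries both** a `≤ 1 / 4`-filled and a `≥ 1`-filled translation-invariant ground state of `H(1,s,U) − μN`, for every `(s, U) ∈ [-3 / 20, 0] × [8, 10]` (`T = 0`). [cite: Israel1979, Thm. I.2.4] [cite: EmeryKivelsonLin1990, pp. 475–476] -/
theorem highU_noMu_1o4_le_1o4_ge_one_A10 (hVB : cert_obx32x4tpm1o4D1200_openbox_32x4_N112_planes)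
    (hK8 : cert_laBoxE_K2diag_GU8n1tpm3o10_j299783_up)
    (h472 : cert_r472_pb2_tl_upper_n1_U8) (h428 : cert_r428_hubSQ_hanK7R6_U8_r5_e4_so4blk)
    (h502 : cert_r502_hubSQ_hanK7R6_U16_r5_e4_so4blk)
    {s : ℝ} (hs : s ∈ Icc (-3 / 20 : ℝ) 0) {U : ℝ} (hU : U ∈ Icc (8 : ℝ) (10))
    {μ : ℝ} {ω₁ ω₂ : InfVolFermionState 2} (hω₁ : ω₁.IsMeanEnergyMinimiser (hubbardTTPrimeMuInteraction 1 s U μ) 1)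
    (hρ₁ : ω₁.density ≤ 1 / 4) (hρ₂ : 1 ≤ ω₂.density) :
    ¬ ω₂.IsMeanEnergyMinimiser (hubbardTTPrimeMuInteraction 1 s U μ) 1 := by
  intro hω₂
  have h := highU_chemPot_gap_1o4_le_1o4_ge_one_A10 hVB hK8 h472 h428 h502 hs hU hω₁ hρ₁ hω₂ hρ₂
  norm_num at h

/-- **`(≤ 1/4 | ≥ 1)`: `Δμ ≥ t/4` on `t′ ∈ [−1/5, 0] × U ∈ [8, 10]`** (columns `U = 8` law ∣ `tri_n1_law10m_of`) (`g = 5 / 192` ≤ every column margin, `M_min = 0.0284`). [cite: Israel1979, Thm. I.2.4] [cite: EmeryKivelsonLin1990, pp. 475–476] [cite: Ruelle1969, §3.3] -/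
theorem highU_chemPot_gap_1o4_le_1o4_ge_one_B (hVB : cert_obx32x4tpm1o4D1200_openbox_32x4_N112_planes)
    (hK8 : cert_laBoxE_K2diag_GU8n1tpm3o10_j299783_up)
    (h472 : cert_r472_pb2_tl_upper_n1_U8) (h428 : cert_r428_hubSQ_hanK7R6_U8_r5_e4_so4blk)
    (h489 : cert_r489_hubSQ_hanK7R6_U12_r5_e4_so4blk) (h502 : cert_r502_hubSQ_hanK7R6_U16_r5_e4_so4blk)
    {s : ℝ} (hs : s ∈ Icc (-1 / 5 : ℝ) 0) {U : ℝ} (hU : U ∈ Icc (8 : ℝ) (10))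
    {μ₁ μ₂ : ℝ} {ω₁ ω₂ : InfVolFermionState 2}
    (hω₁ : ω₁.IsMeanEnergyMinimiser (hubbardTTPrimeMuInteraction 1 s U μ₁) 1) (hρ₁ : ω₁.density ≤ 1 / 4)
    (hω₂ : ω₂.IsMeanEnergyMinimiser (hubbardTTPrimeMuInteraction 1 s U μ₂) 1) (hρ₂ : 1 ≤ ω₂.density) :
    (1 : ℝ) / 4 ≤ μ₂ - μ₁ := by
  have k := psGC_gap_on_cell_of_columns 1 (s₁ := -1 / 5) (s₂ := 0) (U₁ := 8) (U₂ := 10)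
    (n₁ := 1 / 4) (n₂ := 1) (a := 1 / 6) (b := 5 / 6) (g := 5 / 192)
    (by norm_num) (by norm_num) (by norm_num) (by norm_num) (by norm_num) (by norm_num) (by norm_num) (by norm_num)
    (lsco78_capPlane_on_cell_of hVB (by norm_num) (by norm_num) (by norm_num))
    (fun s hs => lsco_n1_law8_of hK8 h472 h428 s ⟨hs.1.trans' (by norm_num), hs.2⟩)
    (fun s hs => tri_n1_law10m_of hK8 h472 h428 h489 h502 s hs)
    (fun s hs U hU => strip_dilute1o4_floor (n₁ := 1 / 4) (by norm_num) (by norm_num) s ⟨hs.1.trans' (by norm_num), hs.2⟩ U (by linarith [hU.1]))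
    ?_ ?_ hs hU hω₁ (meanEnergy_hubbardTTPrimeMu_eq_sub 1 s U μ₁) hω₂ (meanEnergy_hubbardTTPrimeMu_eq_sub 1 s U μ₂) hρ₁ hρ₂
  · linarith
  · intro s hs; obtain ⟨h1, h2⟩ := hs; push_cast; norm_num; nlinarith [h1, h2]
  · intro s hs; obtain ⟨h1, h2⟩ := hs; push_cast; norm_num; nlinarith [h1, h2]

/-- **No `μ` carries both** a `≤ 1 / 4`-filled and a `≥ 1`-filled translation-invariant ground state of `H(1,s,U) − μN`, for every `(s, U) ∈ [-1 / 5, 0] × [8, 10]` (`T = 0`). [cite: Israel1979, Thm. I.2.4] [cite: EmeryKivelsonLin1990, pp. 475–476] -/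
theorem highU_noMu_1o4_le_1o4_ge_one_B (hVB : cert_obx32x4tpm1o4D1200_openbox_32x4_N112_planes)
    (hK8 : cert_laBoxE_K2diag_GU8n1tpm3o10_j299783_up)
    (h472 : cert_r472_pb2_tl_upper_n1_U8) (h428 : cert_r428_hubSQ_hanK7R6_U8_r5_e4_so4blk)
    (h489 : cert_r489_hubSQ_hanK7R6_U12_r5_e4_so4blk) (h502 : cert_r502_hubSQ_hanK7R6_U16_r5_e4_so4blk)
    {s : ℝ} (hs : s ∈ Icc (-1 / 5 : ℝ) 0) {U : ℝ} (hU : U ∈ Icc (8 : ℝ) (10))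
    {μ : ℝ} {ω₁ ω₂ : InfVolFermionState 2} (hω₁ : ω₁.IsMeanEnergyMinimiser (hubbardTTPrimeMuInteraction 1 s U μ) 1)
    (hρ₁ : ω₁.density ≤ 1 / 4) (hρ₂ : 1 ≤ ω₂.density) :
    ¬ ω₂.IsMeanEnergyMinimiser (hubbardTTPrimeMuInteraction 1 s U μ) 1 := by
  intro hω₂
  have h := highU_chemPot_gap_1o4_le_1o4_ge_one_B hVB hK8 h472 h428 h489 h502 hs hU hω₁ hρ₁ hω₂ hρ₂
  norm_num at h

/-- **`(≤ 3/10 | ≥ 1)`: `Δμ ≥ t/4` on `t′ ∈ [−1/10, 0] × U ∈ [8, 9]`** (second column `hU_n1_law9_of_12t`; rows touching at `3/10`) (`g = 23 / 896` ≤ every column margin, `M_min = 0.0260`). [cite: Israel1979, Thm. I.2.4] [cite: EmeryKivelsonLin1990, pp. 475–476] [cite: Ruelle1969, §3.3] -/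
theorem highU_chemPot_gap_1o4_le_3o10_ge_one_A9 (hVB : cert_obx32x4tpm1o4D1200_openbox_32x4_N112_planes)
    (hK8 : cert_laBoxE_K2diag_GU8n1tpm3o10_j299783_up)
    (h472 : cert_r472_pb2_tl_upper_n1_U8) (h428 : cert_r428_hubSQ_hanK7R6_U8_r5_e4_so4blk)
    (h489 : cert_r489_hubSQ_hanK7R6_U12_r5_e4_so4blk) (h502 : cert_r502_hubSQ_hanK7R6_U16_r5_e4_so4blk)
    {s : ℝ} (hs : s ∈ Icc (-1 / 10 : ℝ) 0) {U : ℝ} (hU : U ∈ Icc (8 : ℝ) (9))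
    {μ₁ μ₂ : ℝ} {ω₁ ω₂ : InfVolFermionState 2}
    (hω₁ : ω₁.IsMeanEnergyMinimiser (hubbardTTPrimeMuInteraction 1 s U μ₁) 1) (hρ₁ : ω₁.density ≤ 3 / 10)
    (hω₂ : ω₂.IsMeanEnergyMinimiser (hubbardTTPrimeMuInteraction 1 s U μ₂) 1) (hρ₂ : 1 ≤ ω₂.density) :
    (1 : ℝ) / 4 ≤ μ₂ - μ₁ := by
  have k := psGC_gap_on_cell_of_columns 1 (s₁ := -1 / 10) (s₂ := 0) (U₁ := 8) (U₂ := 9)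
    (n₁ := 3 / 10) (n₂ := 1) (a := 5 / 28) (b := 23 / 28) (g := 23 / 896)
    (by norm_num) (by norm_num) (by norm_num) (by norm_num) (by norm_num) (by norm_num) (by norm_num) (by norm_num)
    (lsco78_capPlane_on_cell_of hVB (by norm_num) (by norm_num) (by norm_num))
    (fun s hs => lsco_n1_law8_of hK8 h472 h428 s ⟨hs.1.trans' (by norm_num), hs.2⟩)
    (hU_n1_law9_of_12t hK8 h472 h428 h489 h502)
    (fun s hs U hU => strip_dilute3o10_floor (n₁ := 3 / 10) (by norm_num) (by norm_num) s ⟨hs.1.trans' (by norm_num), hs.2⟩ U (by linarith [hU.1]))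
    ?_ ?_ hs hU hω₁ (meanEnergy_hubbardTTPrimeMu_eq_sub 1 s U μ₁) hω₂ (meanEnergy_hubbardTTPrimeMu_eq_sub 1 s U μ₂) hρ₁ hρ₂
  · linarith
  · intro s hs; obtain ⟨h1, h2⟩ := hs; push_cast; norm_num; nlinarith [h1, h2]
  · intro s hs; obtain ⟨h1, h2⟩ := hs; push_cast; norm_num; nlinarith [h1, h2]

/-- **No `μ` carries both** a `≤ 3 / 10`-filled and a `≥ 1`-filled translation-invariant ground state of `H(1,s,U) − μN`, for every `(s, U) ∈ [-1 / 10, 0] × [8, 9]` (`T = 0`). [cite: Israel1979, Thm. I.2.4] [cite: EmeryKivelsonLin1990, pp. 475–476] -/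
theorem highU_noMu_1o4_le_3o10_ge_one_A9 (hVB : cert_obx32x4tpm1o4D1200_openbox_32x4_N112_planes)
    (hK8 : cert_laBoxE_K2diag_GU8n1tpm3o10_j299783_up)
    (h472 : cert_r472_pb2_tl_upper_n1_U8) (h428 : cert_r428_hubSQ_hanK7R6_U8_r5_e4_so4blk)
    (h489 : cert_r489_hubSQ_hanK7R6_U12_r5_e4_so4blk) (h502 : cert_r502_hubSQ_hanK7R6_U16_r5_e4_so4blk)
    {s : ℝ} (hs : s ∈ Icc (-1 / 10 : ℝ) 0) {U : ℝ} (hU : U ∈ Icc (8 : ℝ) (9))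
    {μ : ℝ} {ω₁ ω₂ : InfVolFermionState 2} (hω₁ : ω₁.IsMeanEnergyMinimiser (hubbardTTPrimeMuInteraction 1 s U μ) 1)
    (hρ₁ : ω₁.density ≤ 3 / 10) (hρ₂ : 1 ≤ ω₂.density) :
    ¬ ω₂.IsMeanEnergyMinimiser (hubbardTTPrimeMuInteraction 1 s U μ) 1 := by
  intro hω₂
  have h := highU_chemPot_gap_1o4_le_3o10_ge_one_A9 hVB hK8 h472 h428 h489 h502 hs hU hω₁ hρ₁ hω₂ hρ₂
  norm_num at h

end Summit.Ventures.CertifiedManyBodySolver.Observables
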